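import Summits.NavierStokesRegularity.NavierStokesRegularity.Theorems.TerminalTraceTypeITraceScarL3LogMeanApexEngine
import Summits.NavierStokesRegularity.NavierStokesRegularity.Theorems.TerminalTraceTypeITraceScarL3SqrtTwoApexReprSliceBounds
import Summits.NavierStokesRegularity.NavierStokesRegularity.Theorems.TerminalTraceTypeITraceScarL3SqrtTwoApexShellPressureMild
import Literature.Analysis.FluidPDE.TypeIRateClassicalRepresentative
import HarnessLib

/-!
# T28-B «CEILING AND MEAN» at package level, UNCONDITIONAL: the log-mean twin of T27-A
# (ROUND-28 §3; item `TerminalTrace.TypeITraceScarL3`, stmt-NavierStokesRegularity-18385, Stub LOUD line; helper)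

Seat nsreg-C26-p1 g2 (cell ns-regularity-ideate), `--supports stmt-NavierStokesRegularity-18385` (helper);
planner-of-record nsreg-p2 g29 (ROUND-28 «CEILING AND MEAN» §3 T28-A/B, DIRECTOR-NS #130 (2) «T28-C (A)»).

* `norm_repr_le_rate_of_ae` — the a.e. → pointwise transfer of a CONTINUOUS time-dependent rate to the continuous
  representative: `‖U‖ ≤ β(s)` a.e. on `]T,0[ × ℝ³`, `U = V` a.e., `V` continuous, `β` continuous on `]T,0[`
  ⟹ `‖V(s, y)‖ ≤ β(s)` for every `s ∈ ]T,0[` and every `y` (an open null set is empty).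
* **`one_le_logMean_of_quietShell`** — T28-B's threshold, the twin of `two_le_rateSq_of_quietShell` (p605200):
  an extinct Type-I apex of class `(M, D₀, C)` (suitable in every `Q(a)`, weak gradient, `𝐈(Q(a)) ≤ M`,
  `D ≤ D₀` at apices, rate `‖U(s)‖ ≤ C/√(−s)` a.e. with ANY constant `C`, weakly null top) that is BACKWARD
  SINGULAR at the origin and QUIET on one shell slab `]−δ,0[ × {R < |y| < AR}`, and whose velocity obeys on a
  final slab `]T,0[ × ℝ³` the a.e. rate `‖U(s, y)‖ ≤ β(s)` with `β` continuous, `β(s)² ≤ 2p(s)/(−s)`, `p ≥ 0`,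
  `P' = p/(−s)` and the LOG-MEAN HYPOTHESIS (LM_q): `P(s) − P(s') ≤ q·log((−s')/(−s)) + K₀` (`T < s' ≤ s < 0`),
  has `1 ≤ q`.  Proof = the proof of T27-A verbatim (classical Oseen-mild representative
  `exists_classical_repr_of_apexPackage`, window shell budgets by `exists_shellBudget_of_mild` fed by
  `lintegral_ball_repr_sq_le` and `norm_repr_le_of_quietShell`) into the log-mean engine
  `one_le_logMean_of_quietShell_of_reprBudget`.  With `β ≡ C/√(−s)`, `p ≡ q = C²/2`, `K₀ = 0` it is T27-A.

WHAT THIS IS NOT: not T28-C (the transfer of (LM_q) through the zoom of a blow-up is not here), not Stub LOUD,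
NOT a proof of Navier–Stokes regularity: a statement about a hypothetical extinct Type-I blow-up profile.
[folklore; Ghidaglia 1986; Agmon–Nirenberg 1967; Temam IDDS 1997 §III.6 L6.1; Seregin2014 Prop. 6.20;
CaffarelliKohnNirenberg1982 Thm B; KochNadirashviliSereginSverak2009 §4; EscauriazaSereginSverak2003 §3]
-/

noncomputable section

set_option linter.dupNamespace false

namespace Summit.NavierStokesRegularity.NavierStokesRegularity.Theorems.TypeITraceScarL3

open MeasureTheory Set Function Filter Topology Metric InnerProductSpace
open Literature.Analysis Literature.Analysis.FluidPDE Literature.Analysis.UnboundedOperators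
open scoped NNReal ENNReal RealInnerProductSpace ContDiff

/-- A continuous time-dependent rate holding a.e. on an open final slab holds pointwise for the continuous
representative: an open set of measure zero is empty. -/
theorem norm_repr_le_rate_of_ae {U V : ℝ → EuclideanSpace ℝ (Fin 3) → EuclideanSpace ℝ (Fin 3)} {T : ℝ}
    {β : ℝ → ℝ}
    (hβU : ∀ᵐ z ∂(volume.restrict (Ioo T 0 ×ˢ (univ : Set (EuclideanSpace ℝ (Fin 3))))), ‖U z.1 z.2‖ ≤ β z.1)
    (hUV : ∀ᵐ w ∂(volume.restrict (Iio (0 : ℝ) ×ˢ (univ : Set (EuclideanSpace ℝ (Fin 3))))),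
      uncurry U w = uncurry V w)
    (hVc : ContinuousOn (uncurry V) (Iio (0 : ℝ) ×ˢ (univ : Set (EuclideanSpace ℝ (Fin 3)))))
    (hβc : ContinuousOn β (Ioo T 0)) :
    ∀ s ∈ Ioo T 0, ∀ y : EuclideanSpace ℝ (Fin 3), ‖V s y‖ ≤ β s := by
  set Ω : Set (ℝ × EuclideanSpace ℝ (Fin 3)) := Ioo T 0 ×ˢ (univ : Set (EuclideanSpace ℝ (Fin 3))) with hΩ
  have hΩo : IsOpen Ω := isOpen_Ioo.prod isOpen_univ
  have hΩslab : Ω ⊆ Iio (0 : ℝ) ×ˢ univ := prod_mono (fun t ht => ht.2) subset_rfl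
  have hVK : ∀ᵐ z ∂(volume.restrict Ω), ‖V z.1 z.2‖ ≤ β z.1 := by
    filter_upwards [hβU, ae_restrict_of_ae_restrict_of_subset hΩslab hUV] with z hz hz2
    have e : U z.1 z.2 = V z.1 z.2 := hz2
    rw [← e]; exact hz
  have hc : ContinuousOn (fun z : ℝ × EuclideanSpace ℝ (Fin 3) => β z.1 - ‖V z.1 z.2‖) Ω :=
    (hβc.comp continuous_fst.continuousOn fun z hz => hz.1).sub (hVc.mono hΩslab).norm
  intro t ht y
  have hzΩ : (t, y) ∈ Ω := ⟨ht, mem_univ _⟩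
  by_contra hlt
  rw [not_le] at hlt
  set N : Set (ℝ × EuclideanSpace ℝ (Fin 3)) := Ω ∩ (fun z => β z.1 - ‖V z.1 z.2‖) ⁻¹' Iio 0 with hN
  have hNopen : IsOpen N := hc.isOpen_inter_preimage hΩo isOpen_Iio
  have hNpos : 0 < volume N := hNopen.measure_pos volume ⟨(t, y), hzΩ, by simp only [mem_preimage, mem_Iio]; linarith⟩
  have hNzero : volume N = 0 := by
    have h1 : ∀ᵐ z ∂(volume : Measure (ℝ × EuclideanSpace ℝ (Fin 3))), z ∈ Ω → ‖V z.1 z.2‖ ≤ β z.1 :=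
      (ae_restrict_iff' hΩo.measurableSet).1 hVK
    refine measure_mono_null (fun z hzN => ?_) (ae_iff.1 h1)
    intro hz
    have h2 : β z.1 - ‖V z.1 z.2‖ < 0 := hzN.2
    exact absurd (hz hzN.1) (not_le.2 (by linarith))
  exact absurd hNzero hNpos.ne'

/-- **T28-B «ceiling and mean» at package level (ROUND-28 §3), unconditional**: the log-mean twin of T27-A.
[folklore; Ghidaglia 1986; Agmon–Nirenberg 1967; Temam IDDS 1997 §III.6; Seregin2014 Prop. 6.20;
CaffarelliKohnNirenberg1982 Thm B] -/
theorem one_le_logMean_of_quietShell :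
    ∀ (M D₀ : ℝ≥0) (C : ℝ)
      (U : ℝ → EuclideanSpace ℝ (Fin 3) → EuclideanSpace ℝ (Fin 3))
      (P : ℝ → EuclideanSpace ℝ (Fin 3) → ℝ)
      (G : ℝ → EuclideanSpace ℝ (Fin 3) →
        EuclideanSpace ℝ (Fin 3) →L[ℝ] EuclideanSpace ℝ (Fin 3)),
      (∀ a : ℝ, 0 < a →
        IsSuitableWeakSolutionInBall a (0 : ℝ × EuclideanSpace ℝ (Fin 3)) U P) →
      (∀ a : ℝ, 0 < a →
        HasWeakSpatialGradientOn
          (parabolicCylinderOpens a (0 : ℝ × EuclideanSpace ℝ (Fin 3))) U G) →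
      (∀ a : ℝ, 0 < a →
        typeIBound (parabolicCylinder a (0 : ℝ × EuclideanSpace ℝ (Fin 3))) U P G ≤ M) →
      (∀ z₀ : ℝ × EuclideanSpace ℝ (Fin 3), z₀.1 ≤ 0 →
        ∀ r : ℝ, 0 < r → cknD r z₀ P ≤ D₀) →
      (∀ s : ℝ, s < 0 →
        ∀ᵐ y : EuclideanSpace ℝ (Fin 3), ‖U s y‖ ≤ C / Real.sqrt (-s)) →
      (∀ φ : EuclideanSpace ℝ (Fin 3) → EuclideanSpace ℝ (Fin 3),
        ContDiff ℝ (⊤ : ℕ∞) φ →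
        HasCompactSupport φ → ∀ ε : ℝ, 0 < ε →
        ∃ s₀ : ℝ, s₀ < 0 ∧ ∀ᵐ s ∂(volume.restrict (Ioo s₀ 0)), |∫ y, ⟪U s y, φ y⟫| ≤ ε) →
      IsBackwardSingularPoint U (0 : ℝ × EuclideanSpace ℝ (Fin 3)) →
      ∀ (A R δ K : ℝ), 1 < A → 0 < R → 0 < δ →
        (∀ᵐ z ∂(volume.restrict
          (Ioo (-δ) 0 ×ˢ {y : EuclideanSpace ℝ (Fin 3) | R < ‖y‖ ∧ ‖y‖ < A * R})),
            ‖U z.1 z.2‖ ≤ K) →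
      ∀ (T : ℝ) (β p Pβ : ℝ → ℝ) (q K₀ : ℝ), T < 0 → 0 ≤ K₀ →
        (∀ᵐ z ∂(volume.restrict (Ioo T 0 ×ˢ (univ : Set (EuclideanSpace ℝ (Fin 3))))),
          ‖U z.1 z.2‖ ≤ β z.1) →
        ContinuousOn β (Ioo T 0) →
        (∀ s ∈ Ioo T 0, β s ^ 2 ≤ 2 * p s / (-s)) → (∀ s ∈ Ioo T 0, 0 ≤ p s) →
        (∀ s ∈ Ioo T 0, HasDerivAt Pβ (p s / (-s)) s) →
        (∀ s' ∈ Ioo T 0, ∀ s ∈ Ioo T 0, s' ≤ s →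
          Pβ s - Pβ s' ≤ q * Real.log ((-s') / (-s)) + K₀) →
        1 ≤ q := by
  intro M D₀ C U P G hsw hG hI hD hrate htop hsing A R δ K hA hR hδ hq T β p Pβ q K₀ hT hK₀ hβU hβc hpβ
    hpnn hP hLM
  -- ### the classical Oseen-mild representative below the top
  obtain ⟨V, hUV, hVc, hdec, hsm, -, hmild, hwin, -⟩ := exists_classical_repr_of_apexPackage hsw hI hrate
  have hUVs := ae_slice_eq_of_ae_eq_slab hUV
  have hC0 : 0 ≤ C := by
    have h := hdec (-1) (by norm_num) 0
    rw [neg_neg, Real.sqrt_one, div_one] at h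
    exact (norm_nonneg _).trans h
  have hAR : R < A * R := by nlinarith
  have hr : 0 < A * R := by positivity
  have h2r : 0 < 2 * (A * R) := by positivity
  -- ### the shell-budget constants at scale `r = A R`
  obtain ⟨Cb, Fb, hCb, hFb, hbud⟩ := exists_shellBudget_of_mild hr
  have hvolT : volume {z : EuclideanSpace ℝ (Fin 3) | R < ‖z‖ ∧ ‖z‖ < A * R} ≠ ⊤ := by
    refine ne_top_of_le_ne_top (measure_ball_lt_top (μ := volume) (x := (0 : EuclideanSpace ℝ (Fin 3)))
      (r := A * R)).ne (measure_mono fun z hz => ?_)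
    rw [mem_ball_zero_iff]; exact hz.2
  -- the uniform bound `B₀`
  obtain ⟨B₀, hB₀def⟩ : ∃ B₀ : ℝ≥0∞, B₀ =
      Cb * ENNReal.ofReal K ^ 2 * volume {z : EuclideanSpace ℝ (Fin 3) | R < ‖z‖ ∧ ‖z‖ < A * R} +
        (ENNReal.ofReal ((2 * Real.pi * (4 * (A * R - R) / 9) ^ 3)⁻¹) * ENNReal.ofReal (2 * (2 * (A * R)) * M) +
            Fb * ENNReal.ofReal (2 * (A * R) * M)) *
          volume {z : EuclideanSpace ℝ (Fin 3) | R < ‖z‖ ∧ ‖z‖ < A * R} := ⟨_, rfl⟩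
  have hB₀ : B₀ ≠ ⊤ := by
    rw [hB₀def]
    refine ENNReal.add_ne_top.2 ⟨ENNReal.mul_ne_top (ENNReal.mul_ne_top hCb (ENNReal.pow_ne_top ENNReal.ofReal_ne_top)) hvolT,
      ENNReal.mul_ne_top (ENNReal.add_ne_top.2 ⟨ENNReal.mul_ne_top ENNReal.ofReal_ne_top ENNReal.ofReal_ne_top,
        ENNReal.mul_ne_top hFb ENNReal.ofReal_ne_top⟩) hvolT⟩
  -- ### the budget of every window pressure at every late time
  have hPq : ∃ mP δP : ℝ, 0 < δP ∧ ∀ t ∈ Ioo (-δP) 0,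
      ∀ (a c : ℝ) (q : ℝ → EuclideanSpace ℝ (Fin 3) → ℝ), t ∈ Ioo a c →
        IsClassicalNSSolutionOn (Ioo a c) 1 0 V q →
        ∃ cst : ℝ, ∫ y in {y : EuclideanSpace ℝ (Fin 3) |
          (5 * R + 4 * (A * R)) / 9 ≤ ‖y‖ ∧ ‖y‖ ≤ (4 * R + 5 * (A * R)) / 9}, |q t y - cst| ≤ mP := by
    refine ⟨B₀.toReal, min δ ((A * R) ^ 2), lt_min hδ (by positivity), fun t ht a c q htac hcl => ?_⟩
    have htδ : -δ < t := lt_of_le_of_lt (neg_le_neg (min_le_left _ _)) ht.1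
    have htr : -(A * R) ^ 2 < t := lt_of_le_of_lt (neg_le_neg (min_le_right _ _)) ht.1
    have ht0 : t < 0 := ht.2
    -- the time window `[t − η, t + η] ⊆ ]a, c[ ∩ ]−∞, 0[`
    obtain ⟨η, hηdef⟩ : ∃ η : ℝ, η = min (min (t - a) (c - t)) (-t) / 2 := ⟨_, rfl⟩
    have hη : 0 < η := by
      rw [hηdef]; exact half_pos (lt_min (lt_min (by linarith [htac.1]) (by linarith [htac.2])) (by linarith))
    have hη1 : η ≤ (t - a) / 2 := by
      rw [hηdef]; linarith [min_le_left (min (t - a) (c - t)) (-t), min_le_left (t - a) (c - t)]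
    have hη2 : η ≤ (c - t) / 2 := by
      rw [hηdef]; linarith [min_le_left (min (t - a) (c - t)) (-t), min_le_right (t - a) (c - t)]
    have hη3 : η ≤ -t / 2 := by rw [hηdef]; linarith [min_le_right (min (t - a) (c - t)) (-t)]
    have hIcc : Icc (t - η) (t + η) ⊆ Ioo a c := fun s hs => ⟨by linarith [hs.1], by linarith [hs.2]⟩
    have htop' : t + η < 0 := by linarith
    -- the sup bound `M' = C/√(−(t+η))` on the window (rate)
    have hsq : 0 < Real.sqrt (-(t + η)) := Real.sqrt_pos.2 (by linarith)
    have hM'0 : 0 ≤ C / Real.sqrt (-(t + η)) := div_nonneg hC0 hsq.le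
    have hM' : ∀ σ ∈ Icc (t - η) (t + η), ∀ y, ‖V σ y‖ ≤ C / Real.sqrt (-(t + η)) := by
      intro σ hσ y
      have hσ0 : σ < 0 := by linarith [hσ.2]
      refine (hdec σ hσ0 y).trans (div_le_div_of_nonneg_left hC0 hsq ?_)
      exact Real.sqrt_le_sqrt (by linarith [hσ.2])
    -- the Oseen-mild clause on the window
    have hmild' : ∀ s t' : ℝ, s ∈ Icc (t - η) (t + η) → t' ∈ Icc (t - η) (t + η) → s < t' → ∀ x,
        V t' x = heatExtension (V s) (t' - s) x - oseenDuhamel 1 s V V t' x :=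
      fun s t' _ ht' hst' x => hmild s t' hst' (by linarith [ht'.2]) x
    -- the A-Morrey bound at time `t` and the quiet bound
    have hα : ∀ z : EuclideanSpace ℝ (Fin 3), ∫⁻ y in ball z (A * R), ‖V t y‖ₑ ^ 2 ≤
        ENNReal.ofReal (2 * (A * R) * M) := fun z => lintegral_ball_repr_sq_le hI hUVs hsm hr z ⟨htr, ht0⟩
    have hKb : ∀ y : EuclideanSpace ℝ (Fin 3), R < ‖y‖ → ‖y‖ < A * R → ‖V t y‖ ≤ K :=
      norm_repr_le_of_quietShell hq hUV hVc t ⟨htδ, ht0⟩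
    -- the budget
    obtain ⟨κ, hκ⟩ := hbud isOpen_Ioo hcl hη hIcc hM'0 hM' hmild' hα (by linarith) hKb
    have hθ : 0 < 4 * (A * R - R) / 9 := by linarith
    have hle := hκ (4 * (A * R - R) / 9) ((5 * R + 4 * (A * R)) / 9) ((4 * R + 5 * (A * R)) / 9) hθ
      (by linarith) (by linarith) (by linarith)
    -- the `2r`-ball term at time `t`
    have h2ball : ∫⁻ z in ball (0 : EuclideanSpace ℝ (Fin 3)) (2 * (A * R)), ‖V t z‖ₑ ^ 2 ≤
        ENNReal.ofReal (2 * (2 * (A * R)) * M) :=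
      lintegral_ball_repr_sq_le hI hUVs hsm h2r 0 ⟨by nlinarith, ht0⟩
    have hleB : ∫⁻ y in {y : EuclideanSpace ℝ (Fin 3) | (5 * R + 4 * (A * R)) / 9 < ‖y‖ ∧
        ‖y‖ < (4 * R + 5 * (A * R)) / 9}, ‖q t y - κ‖ₑ ≤ B₀ := by
      refine hle.trans ?_
      rw [hB₀def]
      gcongr
    refine ⟨κ, ?_⟩
    have hqm : AEStronglyMeasurable (fun y => q t y - κ) (volume : Measure (EuclideanSpace ℝ (Fin 3))) :=
      ((hcl.contDiff_pressure htac).continuous.sub continuous_const).aestronglyMeasurable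
    exact integral_closedAnnulus_le_of_lintegral_annulus_le hqm hB₀ hleB
  -- ### the engine
  exact one_le_logMean_of_quietShell_of_reprBudget hsw hG hI hD htop hsing hA hR hδ hq hUV hVc hsm
    (fun s hs y => hdec s hs y) hwin hPq hT hK₀ (norm_repr_le_rate_of_ae hβU hUV hVc hβc) hpβ hpnn hP hLM

end Summit.NavierStokesRegularity.NavierStokesRegularity.Theorems.TypeITraceScarL3

end
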